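import Literature.MathematicalPhysics.QuantumFieldTheory.Dimock2011to13.RandomWalkExpansion
import Literature.MathematicalPhysics.QuantumFieldTheory.Dimock2011to13.CovarianceSquareRoot
import Literature.MathematicalPhysics.QuantumFieldTheory.Balaban1983to89.B12Decay510Torus

/-!
# Dimock, *The renormalization group according to Balaban* I, §2.4 LEMMA 6 (`jupiter`) proof L1038–1053 and COROLLARY 7
# proof L1083–1087 ON THE CELL'S TORUS: the one-link sum `Σ_{y′} e^{−½γ₀d(y,y′)} ≤ C` and the chain-of-exponentials bound
# `Σ_{y_1,…,y_n}Π e^{−γd(y_j,y_{j+1})} ≤ K^n e^{−½γd(y,y′)}` INSTANTIATED on `(ℤ∕N)^d` with the periodic ℓ¹ distance — the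
# hypothesis `hK` of `RandomWalkExpansion.sum_exp_chain_le` DISCHARGED by pv12's lattice sum `sum_exp_pl1_le_K₁`

**Citation header (reproduction of PUBLISHED work; template of the Bałaban lattice Yang–Mills cell).**
J. Dimock, *The renormalization group according to Balaban I. Small fields*, Rev. Math. Phys. **25** (2013) 1330010
(= arXiv:1108.1335v2) [Dimock2013], §2.4: the walk bound in the proof of LEMMA `\label{jupiter}` (= Lemma 6) TeX L1038–1053
and the proof of the COROLLARY (= Corollary 7, eq. (gk2)) L1080–1087 (TeX source held by the cell,
`inputs/files/dimock/src/1108.1335/1108.1335.tex`, 7382e6540dded9be).  Dimock's papers are published and refereed and are the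
cell's TEMPLATE, not manuscripts under audit; no quantity of the Bałaban series is touched.

**What the paper prints (verbatim).**  L1049–1053: *"≤ C(CM)^{−n} Σ_{y_1,…,y_n} Π_{j=0}^n e^{−γ₀d(y_j,y_{j+1})}‖f‖_∞ ≤
C(CM)^{−n} e^{−½γ₀d(y,y′)}‖f‖_∞"*.  L1080–1087: *"For x ∈ Δ_y  |(G_kf)(x)| ≤ Σ_{y′}|(G_k1_{Δ_{y′}}f)(x)| ≤ CΣ_{y′}
e^{−½γ₀d(y,y′)}‖f‖_∞ ≤ C‖f‖_∞"*.  L324: *"The distance is |x−y| = sup_μ|x_μ − y_μ|"*.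

**Why this module.**  `RandomWalkExpansion` (this lineage, v1.1 p204022) proves the chain bound `sum_exp_chain_le` for ANY
`d ≥ 0` with the triangle inequality, taking the ONE-LINK SUM `Σ_u e^{−½γd(y,u)} ≤ K` as the hypothesis `hK` (*"a lattice
fact"*).  On the cell's torus model `TPt d N = (ℤ∕N)^d` that lattice fact is ALREADY IN THE TREE: pv12's
`B12Decay510Torus.sum_exp_pl1_le_K₁` (*"Σ_{w∈(ℤ/N)^d} e^{−a|w|} ≤ Σ_{z∈ℤ^d} e^{−a|z|₁} = K₁(d,a)"*, the periodic ℓ¹ norm `pl1`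
via minimal representatives, with `pl1_nonneg`, `pl1_sub_triangle`).  This module puts the two together.

**What is reproduced here (kernel-checked, zero `sorry`).**
* `torusDist y u = pl1 (y − u)` (the periodic ℓ¹ distance), `torusDist_nonneg`, `torusDist_triangle`;
* **`sum_exp_torusDist_le`**: `Σ_{u ∈ (ℤ∕N)^d} e^{−a·torusDist y u} ≤ K₁ d a` for every `y` and `a > 0` (translation
  `u ↦ y − u` + `sum_exp_pl1_le_K₁`) — Corollary 7's *"CΣ_{y′}e^{−½γ₀d(y,y′)} ≤ C"* with `C = K₁(d, ½γ₀)`, uniformly in `N`;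
* **`sum_exp_chain_le_torus`**: `Σ_{y_1,…,y_n ∈ (ℤ∕N)^d} e^{−γ·chainLen} ≤ K₁(d, γ∕2)^n · e^{−(γ∕2)·torusDist y y′}` for every
  `γ > 0`, `n`, `y`, `y′`, uniformly in `N` — the printed L1049–1053 on the torus with `C^n = K₁(d,γ∕2)^n` explicit;
* `walk_bound_torus`: the assembled `C(θK₁)^n e^{−½γ d(y,y′)}`.
* (v1.1) **`abs_mulVec_le_of_torus_decay`**: a kernel on the torus with `|D(y,u)| ≤ C e^{−a·d(y,u)}`, `a > 0`, acts on
  `ℓ^∞` with norm `≤ C·K₁(d,a)` — *"these say |D_{k,r}(y,y′)| ≤ Ce^{−γ₀d(y,y′)} … This gives the L^∞ bound |D_{k,r}W| ≤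
  C‖W‖_∞"* (§4.3 LEMMA 16 proof L2199–2203; also (gk2) L1080–1087) with the constant explicit and uniform in `N`: the
  Schur test `CovarianceSquareRoot.abs_mulVec_le_of_kernel_bound` fed with `sum_exp_torusDist_le` — the form in which
  the App. E input enters `CovarianceSquareRoot.abs_sqrt_Ck_mulVec_le_blockAvg`.

**Readings (declared).**  (i) PERIODIC ℓ¹ DISTANCE in place of the print's sup-distance: `d_∞ ≤ d_1 ≤ d·d_∞` on `(ℤ∕N)^d`,
so decay statements in either distance imply each other up to the factor `d` in the rate; the cell's torus modules
(`B12Decay510Torus`) are built on `pl1`, and the chain bound is insensitive to the choice (any `d ≥ 0` with the triangle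
inequality).  (ii) Unit cubes `Δ_y` ↔ points of `TPt d N` (integer coordinates), as in `TorusBlockAveraging`.  (iii) The
constant is the ℤ^d sum `K₁(d,a) = Σ_{z∈ℤ^d}e^{−a|z|₁}` (finite for `a > 0`, `B12Sec2to5.summable_exp_neg_l1`), an upper
bound uniform in the torus size — the print's `C`.

**What is NOT claimed.**  The local bounds producing the chain sum ((sycamore), the `K_z` estimate); the sup-distance
version verbatim; anything of B1–B16 — `B12Decay510Torus`'s lattice lemmas are used BY NAME as geometry, no printed Bałaban
statement is touched or restated.  NOT summit progress; NOT a statement about any Bałaban paper; NOT continuum; NOT Clay.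
Unit `b2b-balaban-template` gen 31 (journal CLAIM D1-RANDOM-WALK-TORUS-DECAY-KERNEL).

**Version.**  v1.1 — ADDITIVE to v1 (p204232, commit 455c30d01168): + import `Dimock2011to13.CovarianceSquareRoot` (for
the Schur test), + `abs_mulVec_le_of_torus_decay`; every v1 declaration byte-identical (unit `b2b-balaban-template` gen 31,
journal CLAIM D1-TORUS-SCHUR-KERNEL).
-/

noncomputable section

open Finset
open Literature.MathematicalPhysics.QuantumFieldTheory.Balaban1983to89.TreeLengthTorus (TPt)
open Literature.MathematicalPhysics.QuantumFieldTheory.Balaban1983to89.B12Decay510Window (K₁ K₁_nonneg)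
open Literature.MathematicalPhysics.QuantumFieldTheory.Balaban1983to89.B12Decay510Torus
  (pl1 pl1_nonneg pl1_sub_triangle sum_exp_pl1_le_K₁)
open Literature.MathematicalPhysics.QuantumFieldTheory.Dimock2011to13.RandomWalkExpansion

namespace Literature.MathematicalPhysics.QuantumFieldTheory.Dimock2011to13.RandomWalkTorusDecay

variable {d N : ℕ} [NeZero N]

/-- the periodic ℓ¹ distance of the torus `(ℤ∕N)^d` between unit cubes: `torusDist y u = |y − u|₁` (minimal representatives;
reading (i) for the print's sup-distance). [cite: Dimock2013, §2.1 L324 and §2.4 L1040–1052 (arXiv:1108.1335v2 TeX)] -/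
def torusDist (y u : TPt d N) : ℝ := pl1 (y - u)

omit [NeZero N] in
/-- `torusDist ≥ 0`. [cite: Dimock2013, §2.1 L324 (arXiv:1108.1335v2 TeX)] -/
theorem torusDist_nonneg (y u : TPt d N) : 0 ≤ torusDist y u := pl1_nonneg _

/-- the triangle inequality for `torusDist`. [cite: Dimock2013, §2.4 L1049–1052 (the step to `e^{−½γ₀d(y,y′)}`)
(arXiv:1108.1335v2 TeX)] -/
theorem torusDist_triangle (a b c : TPt d N) : torusDist a c ≤ torusDist a b + torusDist b c :=
  pl1_sub_triangle a b c

/-- **THE ONE-LINK SUM ON THE TORUS** — Corollary 7's *"CΣ_{y′}e^{−½γ₀d(y,y′)}‖f‖_∞ ≤ C‖f‖_∞"*: `Σ_{u∈(ℤ∕N)^d}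
e^{−a·d(y,u)} ≤ K₁(d,a)` for every `y` and `a > 0`, uniformly in `N` (translation invariance + pv12's `sum_exp_pl1_le_K₁`).
[cite: Dimock2013, §2.4 Corollary (gk2) proof L1080–1087 (arXiv:1108.1335v2 TeX)] -/
theorem sum_exp_torusDist_le {a : ℝ} (ha : 0 < a) (y : TPt d N) :
    ∑ u : TPt d N, Real.exp (-a * torusDist y u) ≤ K₁ d a := by
  have h : ∑ u : TPt d N, Real.exp (-a * torusDist y u) = ∑ w : TPt d N, Real.exp (-a * pl1 w) := by
    refine Fintype.sum_equiv (Equiv.subLeft y) _ _ fun u => ?_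
    simp [torusDist, Equiv.subLeft]
  rw [h]
  exact sum_exp_pl1_le_K₁ ha

/-- **THE CHAIN BOUND ON THE TORUS**: `Σ_{y_1,…,y_n∈(ℤ∕N)^d} e^{−γ(d(y,y_1) + ⋯ + d(y_n,y′))} ≤ K₁(d,γ∕2)^n e^{−½γd(y,y′)}` for
every `γ > 0`, uniformly in `N` — the printed *"≤ C(CM)^{−n}Σ_{y_1,…,y_n}Π_{j=0}^n e^{−γ₀d(y_j,y_{j+1})}‖f‖_∞ ≤ C(CM)^{−n}
e^{−½γ₀d(y,y′)}‖f‖_∞"* with `C^n = K₁(d,γ∕2)^n`; the hypothesis `hK` of `RandomWalkExpansion.sum_exp_chain_le` discharged by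
`sum_exp_torusDist_le`. [cite: Dimock2013, §2.4 Lemma jupiter proof L1038–1053 (arXiv:1108.1335v2 TeX)] -/
theorem sum_exp_chain_le_torus {γ : ℝ} (hγ : 0 < γ) (n : ℕ) (y y' : TPt d N) :
    ∑ ys : Fin n → TPt d N, Real.exp (-γ * chainLen (torusDist (d := d) (N := N)) n y ys y')
      ≤ K₁ d (γ / 2) ^ n * Real.exp (-(γ / 2) * torusDist y y') :=
  sum_exp_chain_le hγ.le torusDist_nonneg torusDist_triangle
    (fun y => sum_exp_torusDist_le (by linarith) y) n y y'

/-- **the walk bound on the torus**: a length-`n` walk term with kernel bound `C θ^n × (chain sum)` is bounded by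
`C(θ·K₁(d,γ∕2))^n e^{−½γd(y,y′)}` — the print's `C(CM^{−1})^n e^{−½γ₀d(y,y′)}` (`CM^{−1} ↦ θK₁`), uniformly in `N`; with
`RandomWalkExpansion.rowSum_sum_le` (the `3^d` neighbour count) this is every ingredient of (sonic) except the analytic `θ = CM^{−1}`.
[cite: Dimock2013, §2.4 Lemma jupiter proof L1049–1053 and (sonic) L1056–1062 (arXiv:1108.1335v2 TeX)] -/
theorem walk_bound_torus {γ C θ B : ℝ} (hγ : 0 < γ) (hC : 0 ≤ C) (hθ : 0 ≤ θ) (n : ℕ) (y y' : TPt d N)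
    (hB : B ≤ C * θ ^ n * ∑ ys : Fin n → TPt d N, Real.exp (-γ * chainLen (torusDist (d := d) (N := N)) n y ys y')) :
    B ≤ C * (θ * K₁ d (γ / 2)) ^ n * Real.exp (-(γ / 2) * torusDist y y') :=
  walk_bound hγ.le torusDist_nonneg torusDist_triangle (fun y => sum_exp_torusDist_le (by linarith) y) hC hθ n y y' hB

/-! ## (v1.1) Exponentially decaying kernels act boundedly on `ℓ^∞((ℤ∕N)^d)`, uniformly in `N` -/

omit [NeZero N] in
/-- **`|D(y,u)| ≤ Ce^{−a·d(y,u)}` ⟹ `|(DW)_y| ≤ C·K₁(d,a)·‖W‖_∞`** on the torus `(ℤ∕N)^d`, for `a > 0`, `C ≥ 0`, uniformly in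
`N` (*"these say |D_{k,r}(y,y′)| ≤ Ce^{−γ₀d(y,y′)} … This gives the L^∞ bound |D_{k,r}W| ≤ C‖W‖_∞"*): the Schur test
`CovarianceSquareRoot.abs_mulVec_le_of_kernel_bound` with the one-link row sum `sum_exp_torusDist_le`. [cite: Dimock2013,
§4.3 Lemma 11 proof L2199–2203 and §2.4 (gk2) proof L1080–1087 (arXiv:1108.1335v2 TeX)] -/
theorem abs_mulVec_le_of_torus_decay [NeZero N] {C a : ℝ} (hC : 0 ≤ C) (ha : 0 < a)
    (D : Matrix (TPt d N) (TPt d N) ℝ) (hk : ∀ y u, |D y u| ≤ C * Real.exp (-a * torusDist y u))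
    (W : TPt d N → ℝ) (y : TPt d N) : |(D.mulVec W) y| ≤ C * K₁ d a * ‖W‖ :=
  CovarianceSquareRoot.abs_mulVec_le_of_kernel_bound D (fun y u => C * Real.exp (-a * torusDist y u)) hk
    (fun y => by
      show ∑ u, C * Real.exp (-a * torusDist y u) ≤ C * K₁ d a
      rw [← Finset.mul_sum]
      exact mul_le_mul_of_nonneg_left (sum_exp_torusDist_le ha y) hC)
    W y

/-! ## Instance -/

/-- on the circle `ℤ∕5` (`d = 1`): the one-link sum at rate `1` is at most `K₁(1,1) = Σ_{z∈ℤ}e^{−|z|}`. -/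
example (y : TPt 1 5) : ∑ u : TPt 1 5, Real.exp (-1 * torusDist y u) ≤ K₁ 1 1 :=
  sum_exp_torusDist_le one_pos y

end Literature.MathematicalPhysics.QuantumFieldTheory.Dimock2011to13.RandomWalkTorusDecay

end
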